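/-
Copyright (c) 2026 the pub-hodgecm-mathlib formalisation cell (harness21).  R90-TF SLAB, section S10 (Rogawski 1990, §13.8 Prop. 13.8.3 proof, p. 218 L9: the global `H`-datum), the
L-B LETTER of the A2a₂ telescope REDUCED TO ITS TWO E1 CORES; prover K2E3-p21 (g10), dealer R90-C138-plan (g4) DEAL #73 (2026-09-05T03:23:01Z (2)); census
`K2/K2E3-p21/g10/CENSUS-DEAL73-LB-letter.K2E3-p21-g10.md` (ef3cc542).  h413 = `stmt-HodgeConjecture-24833`, route `HCCMUnconditional`.
TWO LETTER PREDICATES `def … (L) (μH) : Prop` (bodies ∀-closed; E1 sig-shape on the consumer side; reviewed lane) + their `Iff.rfl` unfolders + TWO theorems; no `instance`, no notation, no `sorry`; ★-only imports (LAW L9: Theorems ∕ Literature, never `Cruxes/…/Lines`).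
-/
import Summits.HodgeConjecture.HodgeConjecture.Theorems.R90S10FrozenDatumDefs      -- ★ C2: `DiscreteClass`, `IsLinked`, `HasLocalClasses`, `H2`, `H2Loc`, `HLoc`, `Gqs`, `Pl`, … (the L-B letter's whole vocabulary)
import Summits.HodgeConjecture.HodgeConjecture.Theorems.R90S5DiscreteClassMultPos    -- ★ S5: `DiscreteClass.one_le_mult`, `exists_rep`, `mult_mk` (`m(π) ≥ 1` for every discrete class)
import Literature.NumberTheory.Automorphic.HilbertRepSpectrumProofs                -- ★ `ContRepresentation.HasMultiplicityOne.multiplicity_le_one`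
import HarnessLib

/-!
# R90-TF ∕ S10 — THE L-B LETTER («the `H`-side cut of (13.8.3)») FROM ITS TWO E1 CORES: global fibre finiteness and multiplicity one for `U(Φ₂)`
# (`Theorems/R90S10Row2H2OfLetters.lean`; ns `Summit.HodgeConjecture.HodgeConjecture.R90.S10`; lane `--supports stmt-HodgeConjecture-24833 --as helper`)

Print: [Rogawski1990] §13.8 Prop. 13.8.3 (proof) p. 218 L9 («Let `ρ` be a cuspidal representation of `H` …») read through C2's `H`-side cut (`S10HDatum.J∕dρ∕hinjH∕hPHmem∕hlinkH∕hdρ∕hexhH`,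
`Theorems/R90S10FrozenDatumDefs.lean` :247–:264): «the full `t(ρ)`-fibre of `ρ₂` is finite, injective, contains the primitive witness, multiplicity one, exhaustive» [§11.2
Prop. 11.2.1 (a) p. 163; §11.5 Thm. 11.5.1 (a)(b)(c) p. 167; §13.3 p. 199].

## WHAT THIS FILE PROVES (DEAL #73, census verdict «NOT payable in house with zero new debt — exactly two E1 cores, the rest bookkeeping»)
The letter `hB` of ★ p864804 `realiseH₂_of_letters` (`Theorems/R90S10RealiseH2OfLetters.lean` :172–:190; A ED. 10's classed sub-socket `sock_S10_row2H₂LB`) asks, for every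
discrete `PH` of `U(Φ₂)` with finite component `σfH` of local classes `ρ₂`, for a FINITE INJECTIVE enumeration `dρ : J → DiscreteClass (H2 L) μH` of the global fibre
`{d ∣ IsLinked L 2 Φ₂ μH d ρ₂}` containing `[PH]`, each member of multiplicity one.  This file derives it from the TWO E1 CORES, typed as NAMED LETTER PREDICATES in `(L, μH)` (E1 sig-shape `∀ L μH, …` on the consumer side)
(dealer RULING J-LB (R8) 03:27:21Z: «(α′) two classed Ch. 11 letters»; never weaker than `hB` — they are stronger and shorter; a later E1∕S5 payer is BY NAME):
* §0 (B1) **`U2LinkedFibreFiniteLetter`** — GLOBAL FIBRE FINITENESS for `U(Φ₂)` (a predicate in `L μH`, body ∀-closed in `ρ₂`; consumers bind the E1 sig-shape `∀ L μH, U2LinkedFibreFiniteLetter L μH`): `Set.Finite {d : DiscreteClass (H2 L) μH ∣ IsLinked L 2 Φ₂ μH d ρ₂}`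
  («two discrete `π, π′` of `U(2)` with the same finite local classes lie in one global `L`-packet and differ only at `∞`»: [Rogawski1990 Thm. 11.5.1 (a)(b) p. 167] via §11.4
  base change and [JacquetShalika1981] strong multiplicity one for `GL₂∕E`, with [Rogawski1990 Prop. 11.1.1] finite archimedean packets); dealer RULING J-LB (R8) name.
* §0 (B2) **`U2MultOneLetter`** — MULTIPLICITY ONE for `U(Φ₂)` (a predicate in `L μH`; `∀ L μH, U2MultOneLetter L μH` is the `N = 2` TWIN of E1's `sig_K2E1MultiplicityOneU3`, same ★ `HasMultiplicityOne` currency: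
  `((H2 L).rightRegular μH).HasMultiplicityOne` for every CM `L` and automorphic `μH`) [Rogawski1990 Prop. 11.2.1 (a)(b) p. 163, Thm. 11.5.1 (c) p. 167; `ρ(θ)`-packets by
  [LabesseLanglands1979]; modern form [Mok2014 Thm. 2.5.2]]; `u2LinkedFibreFiniteLetter_iff`, `u2MultOneLetter_iff` (`Iff.rfl` unfolders).
* §1 `DiscreteClass.mult_eq_one_of_hasMultiplicityOne` — multiplicity one (★ Lit `HasMultiplicityOne.multiplicity_le_one`) + `m(π) ≥ 1` (★ S5 `DiscreteClass.one_le_mult`) ⇒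
  `d.mult = 1` for every discrete class (any adelic group datum); **`row2H₂_of_letters (hfin : ∀ L μH, U2LinkedFibreFiniteLetter L μH) (hm1 : ∀ L μH, U2MultOneLetter L μH) : ‹hB verbatim›`**.
PROOF: `J := ↥{d ∣ IsLinked …}` (finite by (B1)), `dρ := Subtype.val` (injective), `[PH]` is linked through `⟨PH, WfH, σfH, rfl, hPσfH, hσfH⟩` (★ C2 `IsLinked`), members are linked by
construction, multiplicities by (B2), exhaustiveness by `⟨⟨d, hd⟩, rfl⟩`.
USE: A ED. 10∕11 binds the slot `sock_S10_row2H₂LB` as `row2H₂_of_letters sock_S10_u2LinkedFibreFinite sock_S10_u2MultOne` with `sock_S10_u2LinkedFibreFinite : ∀ L … μH …, U2LinkedFibreFiniteLetter L μH`,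
`sock_S10_u2MultOne : ∀ L … μH …, U2MultOneLetter L μH` (two classed E1 sub-sockets, canonical bytes = §0); p05's DEAL #81 `realiseH₂_dressed … (hB₁ : ∀ L μH, U2LinkedFibreFiniteLetter L μH) (hB₂ : ∀ L μH, U2MultOneLetter L μH) …`
feeds `row2H₂_of_letters hB₁ hB₂`.  The honest label of the A2a₂ telescope then reads «L-B = Rogawski Ch. 11 for `U(2)`: fibre finiteness + multiplicity one», nothing hidden.
HONEST LABEL: the two `def`s are UNPROVED E1-class LETTERS (named inputs, closes nothing) — naming them is not paying them; nearest tree texts are the POSITED readings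
`Literature.NumberTheory.Rogawski1990.Ch11.{thm1151a,thm1151b,thm1151c,prop1121a_mult}` (no bridge to `DiscreteClass`); the theorems are bookkeeping over ★.  HC_CM is proved only modulo the 7 printed citations (2
remaining named inputs: hLiu418 = `stmt-HodgeConjecture-24832`, h413 = `stmt-HodgeConjecture-24833`) until rung 0 closes; REL ≠ ★ ≠ BUILT; count-neutral.

## References
* [Rogawski1990] J. D. Rogawski, *Automorphic Representations of Unitary Groups in Three Variables*, Ann. of Math. Stud. 123 (1990), §11.1 Prop. 11.1.1 p. 161; §11.2 Prop. 11.2.1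
  p. 163; §11.5 Thm. 11.5.1 p. 167; §13.3 p. 199; §13.8 Prop. 13.8.3 (proof) p. 218 L9.
* [JacquetShalika1981] H. Jacquet, J. Shalika, *On Euler products and the classification of automorphic forms II*, Amer. J. Math. 103 (1981), Thm. 4.8.
* [LabesseLanglands1979] J.-P. Labesse, R. P. Langlands, *L-indistinguishability for SL(2)*, Canad. J. Math. 31 (1979).
* [Mok2014] C. P. Mok, *Endoscopic classification of representations of quasi-split unitary groups*, Mem. Amer. Math. Soc. 235 no. 1108 (2014), Thm. 2.5.2.
-/

set_option autoImplicit false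
set_option linter.dupNamespace false

noncomputable section

open scoped RestrictedProduct Matrix MatrixGroups InnerProductSpace
open Filter MeasureTheory NumberField IsDedekindDomain CompactlySupported
open Literature.NumberTheory.Rogawski1990 Literature.NumberTheory.Automorphic Literature.NumberTheory.Automorphic.UnitaryGroup
open Literature.NumberTheory.Automorphic.UnitaryGroup.CotangentForms Literature.NumberTheory.GaloisRepresentations
open Literature.NumberTheory.Automorphic.Arthur2013.Leaves.TECR
open Summit.HodgeConjecture.HodgeConjecture.Cruxes.H413.K2E1TraceFormulaBeta
open Summit.HodgeConjecture.HodgeConjecture.Cruxes.H413.K2E1SpectralTermsDiscreteHalf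

namespace Summit.HodgeConjecture.HodgeConjecture.R90.S10

/-! ## §0 The two E1 cores of the L-B letter, as NAMED LETTER PREDICATES in `(L, μH)` -/

/-- **(B1) `U2LinkedFibreFiniteLetter` — GLOBAL FIBRE FINITENESS FOR `U(Φ₂)`**: for every CM field `L`, every automorphic measure `μH` on `U(Φ₂)(L⁺)∖U(Φ₂)(𝔸_{L⁺})` and every
family `ρ₂ = (ρ_{2,w})_w` of local classes at the finite places, the set of discrete automorphic classes `d` of `U(Φ₂)` LINKED to `ρ₂` (★ C2 `IsLinked`: `d` is the class of an
occurrence witness whose finite component has local classes exactly `ρ₂`) is FINITE — «discrete `π, π′` with the same finite local components lie in one global `L`-packet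
(rigidity) and differ only at the archimedean places, where packets are finite».  An E1-class INPUT (Rogawski Ch. 11 for `U(2)`: base change to `GL₂∕E` + [JS]); a NAME, not a
proof — consumers bind `(h : ∀ L … μH …, U2LinkedFibreFiniteLetter L μH)`. [cite: Rogawski1990, §11.5 Thm. 11.5.1 (a)(b) p. 167; §11.1 Prop. 11.1.1 p. 161; §13.3 p. 199]
[cite: JacquetShalika1981, Thm. 4.8] -/
def U2LinkedFibreFiniteLetter (L : Type) [Field L] [NumberField L] [IsCMField L] (μH : Measure (H2 L).automorphicQuotient) [(H2 L).IsAutomorphicMeasure μH] : Prop :=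
  ∀ ρ₂ : ∀ w : Pl L, IrrClass (H2Loc L w),
    Set.Finite {d : DiscreteClass (H2 L) μH |
      IsLinked L 2 (Matrix.of fun i j : Fin 2 => if i.val + j.val + 1 = 2 then (1 : L) else 0) μH d ρ₂}

/-- Unfolding `U2LinkedFibreFiniteLetter` (byte guard). [cite: Rogawski1990, §11.5 Thm. 11.5.1 (a)(b) p. 167] -/
theorem u2LinkedFibreFiniteLetter_iff (L : Type) [Field L] [NumberField L] [IsCMField L] (μH : Measure (H2 L).automorphicQuotient)
    [(H2 L).IsAutomorphicMeasure μH] :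
    U2LinkedFibreFiniteLetter L μH ↔
      ∀ ρ₂ : ∀ w : Pl L, IrrClass (H2Loc L w),
        Set.Finite {d : DiscreteClass (H2 L) μH |
          IsLinked L 2 (Matrix.of fun i j : Fin 2 => if i.val + j.val + 1 = 2 then (1 : L) else 0) μH d ρ₂} :=
  Iff.rfl

/-- **(B2) `U2MultOneLetter` — MULTIPLICITY ONE FOR `U(Φ₂)`** (the `N = 2` TWIN of E1's `sig_K2E1MultiplicityOneU3`, same currency): for every CM field `L` and every automorphic
measure `μH`, the right regular representation of `U(Φ₂)(𝔸_{L⁺})` on `L²(U(Φ₂)(L⁺)∖U(Φ₂)(𝔸_{L⁺}), μH)` has MULTIPLICITY ONE (★ `ContRepresentation.HasMultiplicityOne`: two unitarily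
equivalent irreducible closed invariant subspaces coincide) — `m(π) = 1` for every discrete `π` of `U(2)` [Prop. 11.2.1 (a)(b) + Thm. 11.5.1 (c); `ρ(θ)`-packets by [LL]; modern
form: Mok's Thm. 2.5.2 for quasi-split `U(N)`].  An E1-class INPUT; a NAME, not a proof — consumers bind `(h : ∀ L … μH …, U2MultOneLetter L μH)`.
[cite: Rogawski1990, §11.2 Prop. 11.2.1 p. 163; §11.5 Thm. 11.5.1 (c) p. 167] [cite: Mok2014, Thm. 2.5.2] -/
def U2MultOneLetter (L : Type) [Field L] [NumberField L] [IsCMField L] (μH : Measure (H2 L).automorphicQuotient) [(H2 L).IsAutomorphicMeasure μH] : Prop :=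
  ((H2 L).rightRegular μH).HasMultiplicityOne

/-- Unfolding `U2MultOneLetter` (byte guard). [cite: Rogawski1990, §11.5 Thm. 11.5.1 (c) p. 167] -/
theorem u2MultOneLetter_iff (L : Type) [Field L] [NumberField L] [IsCMField L] (μH : Measure (H2 L).automorphicQuotient) [(H2 L).IsAutomorphicMeasure μH] :
    U2MultOneLetter L μH ↔ ((H2 L).rightRegular μH).HasMultiplicityOne :=
  Iff.rfl

/-! ## §1 Multiplicity one in the `DiscreteClass.mult` currency; the L-B letter -/

/-- **Multiplicity one ⇒ `m(π) = 1` for every discrete class** (any adelic group datum): `m(π) ≤ 1` by ★ `HasMultiplicityOne.multiplicity_le_one` at a representative (★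
`DiscreteClass.exists_rep`, `mult_mk`), `m(π) ≥ 1` by ★ S5 `DiscreteClass.one_le_mult`. [cite: Dixmier1977, 5.4.6] [cite: Rogawski1990, §13.3 p. 199] -/
theorem mult_eq_one_of_hasMultiplicityOne {K : Type} [Field K] [NumberField K] {𝒢 : AdelicGroupData K} {μ : Measure 𝒢.automorphicQuotient} [𝒢.IsAutomorphicMeasure μ]
    (h : (𝒢.rightRegular μ).HasMultiplicityOne) (d : DiscreteClass 𝒢 μ) : d.mult = 1 := by
  refine le_antisymm ?_ (DiscreteClass.one_le_mult d)
  obtain ⟨P, rfl⟩ := DiscreteClass.exists_rep d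
  rw [DiscreteClass.mult_mk]
  exact_mod_cast h.multiplicity_le_one P.space.toContRep

/-- **THE L-B LETTER FROM ITS TWO E1 CORES** — `row2H₂_of_letters (hfin) (hm1)`: the `H`-side cut of (13.8.3) («the global fibre of `ρ₂` is finite ∋ `[PH]`, injectively enumerated,
multiplicity one, exhaustive»; the binder `hB` of ★ `realiseH₂_of_letters`, VERBATIM) from (B1) GLOBAL FIBRE FINITENESS for `U(Φ₂)` and (B2) MULTIPLICITY ONE for `U(Φ₂)`, both
hypothesis-first by value.  `J := ↥{d ∣ IsLinked …}`, `dρ := Subtype.val`; `[PH]` is linked through its own finite component.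
[cite: Rogawski1990, §13.8 Prop. 13.8.3 (proof) p. 218 L9; §11.2 Prop. 11.2.1 (a) p. 163; §11.5 Thm. 11.5.1 p. 167; §13.3 p. 199] [cite: JacquetShalika1981, Thm. 4.8]
[cite: Mok2014, Thm. 2.5.2] -/
theorem row2H₂_of_letters
    (hfin : ∀ (L : Type) [Field L] [NumberField L] [IsCMField L] (μH : Measure (H2 L).automorphicQuotient) [(H2 L).IsAutomorphicMeasure μH],
      U2LinkedFibreFiniteLetter L μH)
    (hm1 : ∀ (L : Type) [Field L] [NumberField L] [IsCMField L] (μH : Measure (H2 L).automorphicQuotient) [(H2 L).IsAutomorphicMeasure μH],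
      U2MultOneLetter L μH) :
    ∀ (L : Type) [Field L] [NumberField L] [IsCMField L] [DecidableEq (Pl L)] (μ : HeckeCharacter L) (v : Pl L)
      [MeasurableSpace (HLoc L v)] [BorelSpace (HLoc L v)] [MeasurableSpace (Gqs L v)] [BorelSpace (Gqs L v)]
      (νHv : Measure (HLoc L v)) (νQv : Measure (Gqs L v)) [νHv.IsHaarMeasure] [νHv.IsMulRightInvariant] [νQv.IsHaarMeasure] [νQv.IsMulRightInvariant]
      [∀ a : HLoc L v, MeasurableSpace (HLoc L v ⧸ Subgroup.centralizer ({a} : Set (HLoc L v)))]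
      [∀ a : HLoc L v, BorelSpace (HLoc L v ⧸ Subgroup.centralizer ({a} : Set (HLoc L v)))]
      [∀ γ : Gqs L v, MeasurableSpace (Gqs L v ⧸ Subgroup.centralizer ({γ} : Set (Gqs L v)))]
      [∀ γ : Gqs L v, BorelSpace (Gqs L v ⧸ Subgroup.centralizer ({γ} : Set (Gqs L v)))]
      (mHv : OrbitalMeasureFamily (HLoc L v)) (mQv : OrbitalMeasureFamily (Gqs L v)) (πSt : IrrClass (HLoc L v))
      [MeasurableSpace (G3 L).Adelic] [BorelSpace (G3 L).Adelic] [MeasurableSpace (H2 L).Adelic] [BorelSpace (H2 L).Adelic]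
      [MeasurableSpace (GArch L)] [BorelSpace (GArch L)] [MeasurableSpace (HArch L)] [BorelSpace (HArch L)]
      [MeasurableSpace (H1Loc L v)] [BorelSpace (H1Loc L v)] [MeasurableSpace (H1Arch L)] [BorelSpace (H1Arch L)]
      [MeasurableSpace (H1 L).Adelic] [BorelSpace (H1 L).Adelic],
      ∀ (μH : Measure (H2 L).automorphicQuotient) [(H2 L).IsAutomorphicMeasure μH] (νH : Measure (H2 L).Adelic) [νH.IsHaarMeasure] (PH : DiscreteAutomorphicRep (H2 L) μH) (ρ₂ : ∀ w : Pl L, IrrClass (H2Loc L w)) (WfH : Type) [AddCommGroup WfH] [Module ℂ WfH] (σfH : Representation ℂ (finAdelic (↥(maximalRealSubfield L)) L (IsCMField.complexConj L) 2 (Matrix.of fun i j : Fin 2 => if i.val + j.val + 1 = 2 then (1 : L) else 0)) WfH) (hPσfH : PH.HasFinComponent σfH) (hσfH : HasLocalClasses L 2 (Matrix.of fun i j : Fin 2 => if i.val + j.val + 1 = 2 then (1 : L) else 0) σfH ρ₂),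
      ∃ (J : Type) (_ : Finite J) (dρ : J → DiscreteClass (H2 L) μH),
        Function.Injective dρ ∧
        DiscreteClass.mk PH ∈ Set.range dρ ∧
        (∀ j, IsLinked L 2 (Matrix.of fun i j : Fin 2 => if i.val + j.val + 1 = 2 then (1 : L) else 0) μH (dρ j) ρ₂) ∧
        (∀ j, (dρ j).mult = 1) ∧
        ∀ d : DiscreteClass (H2 L) μH, IsLinked L 2 (Matrix.of fun i j : Fin 2 => if i.val + j.val + 1 = 2 then (1 : L) else 0) μH d ρ₂ → d ∈ Set.range dρ := by
  intro L
  intros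
  rename_i μH _ νH _ PH ρ₂ WfH _ _ σfH hPσfH hσfH
  -- the global fibre of `ρ₂`, finite by (B1); `[PH]` lies in it through its own finite component
  have hS := hfin L μH ρ₂
  have hPH : IsLinked L 2 (Matrix.of fun i j : Fin 2 => if i.val + j.val + 1 = 2 then (1 : L) else 0) μH (DiscreteClass.mk PH) ρ₂ :=
    ⟨PH, WfH, _, _, σfH, rfl, hPσfH, hσfH⟩
  exact ⟨↥{d : DiscreteClass (H2 L) μH | IsLinked L 2 (Matrix.of fun i j : Fin 2 => if i.val + j.val + 1 = 2 then (1 : L) else 0) μH d ρ₂},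
    hS.to_subtype, Subtype.val, Subtype.val_injective, ⟨⟨DiscreteClass.mk PH, hPH⟩, rfl⟩, fun j => j.2, fun j => mult_eq_one_of_hasMultiplicityOne (hm1 L μH) j.1,
    fun d hd => ⟨⟨d, hd⟩, rfl⟩⟩

end Summit.HodgeConjecture.HodgeConjecture.R90.S10

end
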